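import Literature.Analysis.Complex.RiemannSphereHolderSections
import Literature.Analysis.FunctionSpaces.ContDiffHolderLocalToGlobal
import HarnessLib

/-!
# Local regularity of sections over the Riemann sphere lifts to the Hölder spaces `𝓗^{k,r}_τ`

Topic `Literature/Analysis/Complex`. For the Hölder spaces `𝓗^{k,r}_τ(F)` of sections of the line
bundle with clutching function `τ` over `S² = ℂ_z ∪ ℂ_w`, `w = z⁻¹`
(`Literature/Analysis/Complex/RiemannSphereHolderSections.lean`: pairs of pieces
`(g₀, g₁) = (ρ • f₀, ρ • f₁)`, `ρ = 1` on `‖z‖ ≤ 2`, `ρ = 0` on `‖z‖ ≥ 3`), regularity of a member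
is read off LOCALLY from its two chart representatives `sec₀`, `sec₁`:

* `memContDiffHolder_fst_of_forall_exists`, `memContDiffHolder_snd_of_forall_exists`,
  `memContDiffHolder_pieces_of_forall_exists` — if `sec₀` is of class `C^{m,r}` near every point of
  the disc `‖z‖ < 3` and `sec₁` near every point of `‖w‖ < 3`, then both pieces are in
  `C^{m,r}_b(ℂ, F)`: `g₀ = ρ • sec₀` is glued from local members along `tsupport ρ ⊆ {‖z‖ ≤ 3}`
  (`MemContDiffHolder.cutoff_smul_of_forall_exists_complex`), the local members at the points
  `‖z‖ = 3` being transported from `sec₁` near `z⁻¹` through the clutching relation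
  `sec₀ z = (τ z⁻¹)⁻¹ • sec₁ z⁻¹` (`exists_memContDiffHolder_smul_comp_inv`);
* `exists_inclCLM_eq_of_memContDiffHolder` — **level lift**: a member of `𝓗^{k,r}_τ` whose two
  pieces are in `C^{k+1,r}_b` is (the image under `inclCLM` of) a member of `𝓗^{k+1,r}_τ` with the
  same chart representatives.

This is the bookkeeping by which elliptic regularity proved chartwise (e.g. for `∂̄`) is returned
to the global section spaces (Joyce 2007, §1.2; Wendl 2018, §2.1.3). Everything is proved; no
named facts.

## References

* D. D. Joyce, *Riemannian Holonomy Groups and Calibrated Geometry* (2007), §1.2. [Joyce2007]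
* C. Wendl, *Holomorphic Curves in Low Dimensions*, LNM 2216 (2018), §2.1.3. [Wendl2018]
-/

noncomputable section

open Set Filter Metric Function
open scoped Topology NNReal ContDiff

namespace Literature.Analysis.Complex

namespace RiemannSphere

open Literature.Analysis.FunctionSpaces

variable {F : Type} [NormedAddCommGroup F] [NormedSpace ℂ F] {τ : ℂ → ℂ} {k m : ℕ} {r : ℝ≥0}

/-! ### The transferred clutching coefficient -/

/-- For `τ` smooth and zero-free off the origin, `z ↦ (τ z⁻¹)⁻¹` is smooth off the origin.
[folklore] -/
theorem contDiffOn_inv_tau_inv (hτ : ∀ w, w ≠ 0 → τ w ≠ 0)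
    (hτs : ContDiffOn ℝ ∞ τ {w | w ≠ 0}) :
    ContDiffOn ℝ ∞ (fun z : ℂ => (τ z⁻¹)⁻¹) {z | z ≠ 0} := by
  intro z hz
  have hz0 : z ≠ 0 := hz
  have hτz : ContDiffAt ℝ ∞ τ z⁻¹ :=
    (hτs z⁻¹ (inv_ne_zero hz0)).contDiffAt (isOpen_ne_zero.mem_nhds (inv_ne_zero hz0))
  exact ((hτz.comp z ((contDiffAt_inv ℂ hz0).restrict_scalars ℝ)).inv
    (hτ _ (inv_ne_zero hz0))).contDiffWithinAt

/-- `‖z‖ ≥ 3 ⇒ ‖z⁻¹‖ < 3`. [folklore] -/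
theorem norm_inv_lt_three_of_three_le {z : ℂ} (hz : 3 ≤ ‖z‖) : ‖z⁻¹‖ < 3 := by
  rw [norm_inv]
  calc ‖z‖⁻¹ ≤ (3 : ℝ)⁻¹ := inv_anti₀ (by norm_num) hz
    _ < 3 := by norm_num

/-! ### Pieces are members from local data on the two discs -/

section Member

variable {p : ContDiffHolderFunction ℂ F k r × ContDiffHolderFunction ℂ F k r}

/-- **The first piece is in `C^{m,r}_b` from local data**: if the `z`-representative of a member
of `𝓗^{k,r}_τ` is of class `C^{m,r}` near every point of `‖z‖ < 3` and the `w`-representative near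
every point of `‖w‖ < 3`, then `g₀ = ρ • sec₀ ∈ C^{m,r}_b(ℂ, F)` (`r ≤ 1`, `τ` smooth and zero-free
off the origin). [cite: Joyce2007, §1.2] -/
theorem memContDiffHolder_fst_of_forall_exists (hr : r ≤ 1) (hp : p ∈ holderSections F τ k r)
    (hτ : ∀ w, w ≠ 0 → τ w ≠ 0) (hτs : ContDiffOn ℝ ∞ τ {w | w ≠ 0})
    (h₀ : ∀ z : ℂ, ‖z‖ < 3 → ∃ W, MemContDiffHolder m r W ∧ W =ᶠ[𝓝 z] sec₀ τ p)
    (h₁ : ∀ w : ℂ, ‖w‖ < 3 → ∃ W, MemContDiffHolder m r W ∧ W =ᶠ[𝓝 w] sec₁ τ p) :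
    MemContDiffHolder m r (p.1 : ℂ → F) := by
  have heq : (p.1 : ℂ → F) = fun z => (rhoCut z : ℂ) • sec₀ τ p z :=
    funext (fst_eq_rhoCut_smul_sec₀ hp)
  rw [heq]
  refine MemContDiffHolder.cutoff_smul_of_forall_exists_complex hr contDiff_rhoCut
    hasCompactSupport_rhoCut fun x _ => ?_
  by_cases hx : ‖x‖ < 3
  · exact h₀ x hx
  · -- `‖x‖ ≥ 3`: transport the local member of `sec₁` at `x⁻¹` through the clutching
    have hx3 : 3 ≤ ‖x‖ := not_lt.1 hx
    have hx0 : x ≠ 0 := ne_zero_of_half_le_norm (le_trans (by norm_num) hx3)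
    obtain ⟨W', hW', hW'eq⟩ := exists_memContDiffHolder_smul_comp_inv hr (inv_ne_zero hx0)
      (h₁ x⁻¹ (norm_inv_lt_three_of_three_le hx3)) (contDiffOn_inv_tau_inv hτ hτs)
    rw [inv_inv] at hW'eq
    refine ⟨W', hW', hW'eq.trans ?_⟩
    filter_upwards [isOpen_ne_zero.mem_nhds hx0] with z hz
    exact (sec₀_eq_smul_sec₁ hp hτ hz).symm

/-- **The second piece is in `C^{m,r}_b` from local data** (symmetrically, through
`sec₁ w = τ w • sec₀ w⁻¹`). [cite: Joyce2007, §1.2] -/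
theorem memContDiffHolder_snd_of_forall_exists (hr : r ≤ 1) (hp : p ∈ holderSections F τ k r)
    (hτ : ∀ w, w ≠ 0 → τ w ≠ 0) (hτs : ContDiffOn ℝ ∞ τ {w | w ≠ 0})
    (h₀ : ∀ z : ℂ, ‖z‖ < 3 → ∃ W, MemContDiffHolder m r W ∧ W =ᶠ[𝓝 z] sec₀ τ p)
    (h₁ : ∀ w : ℂ, ‖w‖ < 3 → ∃ W, MemContDiffHolder m r W ∧ W =ᶠ[𝓝 w] sec₁ τ p) :
    MemContDiffHolder m r (p.2 : ℂ → F) := by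
  have heq : (p.2 : ℂ → F) = fun w => (rhoCut w : ℂ) • sec₁ τ p w :=
    funext (snd_eq_rhoCut_smul_sec₁ hp)
  rw [heq]
  refine MemContDiffHolder.cutoff_smul_of_forall_exists_complex hr contDiff_rhoCut
    hasCompactSupport_rhoCut fun x _ => ?_
  by_cases hx : ‖x‖ < 3
  · exact h₁ x hx
  · -- `‖x‖ ≥ 3`: transport the local member of `sec₀` at `x⁻¹` through the clutching
    have hx3 : 3 ≤ ‖x‖ := not_lt.1 hx
    have hx0 : x ≠ 0 := ne_zero_of_half_le_norm (le_trans (by norm_num) hx3)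
    obtain ⟨W', hW', hW'eq⟩ := exists_memContDiffHolder_smul_comp_inv hr (inv_ne_zero hx0)
      (h₀ x⁻¹ (norm_inv_lt_three_of_three_le hx3)) hτs
    rw [inv_inv] at hW'eq
    refine ⟨W', hW', hW'eq.trans ?_⟩
    filter_upwards [isOpen_ne_zero.mem_nhds hx0] with w hw
    exact (sec₁_eq_smul_sec₀ hp hτ hw).symm

end Member

/-- **Pieces of a section are `C^{m,r}` from local data**: for `p ∈ 𝓗^{k,r}_τ(F)` whose
`z`-representative is of class `C^{m,r}` near every point of `‖z‖ < 3` and whose `w`-representative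
is of class `C^{m,r}` near every point of `‖w‖ < 3`, both pieces belong to `C^{m,r}_b(ℂ, F)`
(`r ≤ 1`, `τ` smooth and zero-free off the origin). [cite: Joyce2007, §1.2] -/
theorem memContDiffHolder_pieces_of_forall_exists (hr : r ≤ 1) (hτ : ∀ w, w ≠ 0 → τ w ≠ 0)
    (hτs : ContDiffOn ℝ ∞ τ {w | w ≠ 0}) (p : holderSections F τ k r)
    (h₀ : ∀ z : ℂ, ‖z‖ < 3 → ∃ W, MemContDiffHolder m r W ∧ W =ᶠ[𝓝 z]
      sec₀ τ (p : ContDiffHolderFunction ℂ F k r × ContDiffHolderFunction ℂ F k r))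
    (h₁ : ∀ w : ℂ, ‖w‖ < 3 → ∃ W, MemContDiffHolder m r W ∧ W =ᶠ[𝓝 w]
      sec₁ τ (p : ContDiffHolderFunction ℂ F k r × ContDiffHolderFunction ℂ F k r)) :
    MemContDiffHolder m r
        ((p : ContDiffHolderFunction ℂ F k r × ContDiffHolderFunction ℂ F k r).1 : ℂ → F) ∧
      MemContDiffHolder m r
        ((p : ContDiffHolderFunction ℂ F k r × ContDiffHolderFunction ℂ F k r).2 : ℂ → F) :=
  ⟨memContDiffHolder_fst_of_forall_exists hr p.2 hτ hτs h₀ h₁,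
    memContDiffHolder_snd_of_forall_exists hr p.2 hτ hτs h₀ h₁⟩

/-! ### Level lift -/

/-- **Level lift**: a member of `𝓗^{k,r}_τ` whose two pieces are in `C^{k+1,r}_b(ℂ, F)` is the
image under the inclusion `𝓗^{k+1,r}_τ → 𝓗^{k,r}_τ` of a member of `𝓗^{k+1,r}_τ` with the same
chart representatives (the piece relations are conditions on the underlying functions only).
[folklore] -/
theorem exists_inclCLM_eq_of_memContDiffHolder [CompleteSpace F] (hr : r ≤ 1)
    (p : holderSections F τ k r)
    (h₁ : MemContDiffHolder (k + 1) r
      ((p : ContDiffHolderFunction ℂ F k r × ContDiffHolderFunction ℂ F k r).1 : ℂ → F))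
    (h₂ : MemContDiffHolder (k + 1) r
      ((p : ContDiffHolderFunction ℂ F k r × ContDiffHolderFunction ℂ F k r).2 : ℂ → F)) :
    ∃ q : holderSections F τ (k + 1) r, inclCLM hr q = p ∧
      (∀ z, sec₀ τ (q : ContDiffHolderFunction ℂ F (k + 1) r ×
          ContDiffHolderFunction ℂ F (k + 1) r) z =
        sec₀ τ (p : ContDiffHolderFunction ℂ F k r × ContDiffHolderFunction ℂ F k r) z) ∧
      ∀ w, sec₁ τ (q : ContDiffHolderFunction ℂ F (k + 1) r ×
          ContDiffHolderFunction ℂ F (k + 1) r) w =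
        sec₁ τ (p : ContDiffHolderFunction ℂ F k r × ContDiffHolderFunction ℂ F k r) w := by
  refine ⟨⟨(⟨_, h₁⟩, ⟨_, h₂⟩), fun z hz => p.2.1 z hz, fun w hw => p.2.2 w hw⟩, ?_,
    fun z => rfl, fun w => rfl⟩
  apply Subtype.ext
  apply Prod.ext <;> exact ContDiffHolderFunction.ext fun _ => rfl

end RiemannSphere

end Literature.Analysis.Complex

end
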